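import Summits.ResolutionOfSingularities.ResolutionOfSingularities.Theorems.EquisingularLiftEquisingularLiftNatP1VBReductionSections
import Literature.AlgebraicGeometry.Modules.PullbackFrame
import Literature.AlgebraicGeometry.Modules.FrameTransition
import Mathlib.AlgebraicGeometry.Morphisms.Proper
import Mathlib.RingTheory.Spectrum.Prime.RingHom
import HarnessLib

/-!
# [OURS · L1 W4.5(b) · T-P1VB part 4] Nowhere-vanishing sections of a vector bundle: frame independence, and
# «a lift of a nowhere-vanishing section is nowhere vanishing» over a universally closed scheme on a local base

Cell res-hironaka, LADDER-RESOLUTION rung L (D-0089), slot W4.5(b), crux `Theses.EquisingularLift.EquisingularLiftNat`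
(stmt-ResolutionOfSingularities-20038) / child `EquisingularLiftNatThree` (stmt-ResolutionOfSingularities-20148); object **T-P1VB**
(res-L1-w45b-lead-2 BOOK 2026-08-27T09:28:20Z, rung v8 DIR₀ of LEAD-MEMO-5: «a lift of a nowhere-vanishing section is nowhere
vanishing on the proper ℙ¹_O ⇒ L := the sub-line-bundle it spans»), `--supports stmt-ResolutionOfSingularities-20148 --as helper`.
NOT a statement of any manuscript; OURS. AI-written; AI review is weaker than expert review.

WHAT.
* `IsNowhereVanishing F s` [OURS def] — a global section `s` of `F` is nowhere vanishing: around every point there is a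
  frame `e : 𝒪^I ≅ F|_W` (tree `Modules/LocalFrames`: `coord e`) in which some coordinate of `s|_W` is invertible at the
  point (`x ∈ D(λ_i(s|_W))`); `exists_mem_basicOpen_coord` / `IsNowhereVanishing.exists_mem_basicOpen` — this holds then
  in EVERY frame around the point (coordinates transform linearly; the non-units of `𝒪_{X,x}` are an ideal), so the
  predicate says `s(x) ≠ 0 ∈ F ⊗ κ(x)` for all `x`;
* `coord_pullbackFrame_unitSection` — in the pulled-back frame `g^*e` (tree `Modules/PullbackFrame`) the coordinates of
  `η(s)` are `g♯(λ_i(s))`;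
* `exists_specializes_mem_range` — for `f : X → Spec A` universally closed, `A` local, and `g` the base change of `Spec φ`,
  `φ : A → B` onto a non-zero ring: every point of `X` specialises to a point of `g(Y)` (`f` is closed, `V(ker φ) ∋ 𝔪_A`);
* **`IsNowhereVanishing.of_unitSection`** — under these hypotheses, for `F` finite locally free and `s ∈ Γ(X, F)`:
  if `η(s) ∈ Γ(Y, g^*F)` is nowhere vanishing then so is `s` (a coordinate invertible at the specialisation `g(y)` of `x`
  is invertible at `x`).
With parts 2b/3 (`exists_unitSection_eq(_projectiveLine)`): a nowhere-vanishing section `σ₀` of `F_k` on `ℙ¹_k` with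
`Ȟ¹(ℙ¹_k; F_k) = 0` lifts to a nowhere-vanishing section of `F` on `ℙ¹_O` — the supplier core of rung v8.

References (index only): Hartshorne II.5 (frames), II Ex. 5.8 (rank / fibre dimension); The Stacks Project, Tag 01WM
(universally closed); Mathlib `Scheme.mem_basicOpen`, `Scheme.Pullback.range_fst`, `range_comap_of_surjective`.
-/

noncomputable section

-- `TopCat.Presheaf`/`Scheme.Modules` are not reducible (as in Mathlib's `AlgebraicGeometry/Modules`).
set_option backward.isDefEq.respectTransparency false

open CategoryTheory AlgebraicGeometry Limits TopologicalSpace Opposite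
open Literature.AlgebraicGeometry.Modules Literature.AlgebraicGeometry.Morphisms Literature.AlgebraicGeometry

universe u

set_option linter.dupNamespace false -- mandated namespace `Summit.<Summit>.<Problem>` of this single-conjunct summit

namespace Summit.ResolutionOfSingularities.ResolutionOfSingularities.Cruxes.EquisingularLiftNat.P1VB

/-! ### Nowhere-vanishing sections -/

section Def

variable {X : Scheme.{u}} (F : X.Modules)

/-- **[OURS] A global section `s` of an `𝒪_X`-module `F` is NOWHERE VANISHING**: every point `x` has an open
neighbourhood `W` carrying a frame `e : 𝒪^I ≅ F|_W` (`I` finite) in which SOME coordinate of `s|_W` is invertible at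
`x` (`x ∈ D(λ_i(s|_W))`); for a finite locally free `F` this does not depend on the frame
(`exists_mem_basicOpen_coord`) and says that `s(x) ≠ 0` in the fibre `F ⊗ κ(x)` for every `x`, i.e. `𝒪_X · s ⊆ F` is a
sub-line-bundle. OURS vocabulary for the v8 rung («a lift of a nowhere-vanishing section is nowhere vanishing on the
proper `ℙ¹_O`»). [folklore] -/
def IsNowhereVanishing (s : Γ(F, ⊤)) : Prop :=
  ∀ x : X, ∃ (W : X.Opens) (_ : x ∈ W) (I : Type u) (_ : Finite I) (e : SheafOfModules.free I ≅ F.over W) (i : I),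
    x ∈ X.basicOpen (coord e (𝟙 W) (F.presheaf.map (homOfLE (le_top : W ≤ ⊤)).op s) i)

variable {F}

/-- A function is NOT invertible at `x` iff its germ lies in the maximal ideal of `𝒪_{X,x}`. [folklore] -/
theorem not_mem_basicOpen_iff_germ_mem_maximalIdeal {U : X.Opens} (c : Γ(X, U)) {x : X} (hx : x ∈ U) :
    x ∉ X.basicOpen c ↔ X.presheaf.germ U x hx c ∈ IsLocalRing.maximalIdeal (X.presheaf.stalk x) := by
  rw [Scheme.mem_basicOpen _ _ _ hx, IsLocalRing.mem_maximalIdeal, mem_nonunits_iff]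

/-- **Frame independence**: if in ONE frame `e` over `W ∋ x` some coordinate of `s|_W` is invertible at `x`, then
in ANY frame `e'` over `W' ∋ x` some coordinate of `s|_{W'}` is invertible at `x` (the coordinates in `e` are
`Γ(X, W ∩ W')`-linear combinations of those in `e'`, and the non-units of `𝒪_{X,x}` form an ideal). [folklore] -/
theorem exists_mem_basicOpen_coord {s : Γ(F, ⊤)} {x : X} {W : X.Opens} (hxW : x ∈ W) {I : Type u} [Finite I]
    (e : SheafOfModules.free I ≅ F.over W)
    (h : ∃ i, x ∈ X.basicOpen (coord e (𝟙 W) (F.presheaf.map (homOfLE (le_top : W ≤ ⊤)).op s) i))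
    {W' : X.Opens} (hxW' : x ∈ W') {I' : Type u} [Finite I'] (e' : SheafOfModules.free I' ≅ F.over W') :
    ∃ j, x ∈ X.basicOpen (coord e' (𝟙 W') (F.presheaf.map (homOfLE (le_top : W' ≤ ⊤)).op s) j) := by
  classical
  haveI := Fintype.ofFinite I'
  by_contra hne
  have hne' : ∀ j, x ∉ X.basicOpen (coord e' (𝟙 W') (F.presheaf.map (homOfLE (le_top : W' ≤ ⊤)).op s) j) :=
    fun j hj => hne ⟨j, hj⟩
  obtain ⟨i, hi⟩ := h
  -- work over `V = W ∩ W'`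
  set V : X.Opens := W ⊓ W' with hV
  have hxV : x ∈ V := ⟨hxW, hxW'⟩
  let k : V ⟶ W := homOfLE inf_le_left
  let k' : V ⟶ W' := homOfLE inf_le_right
  set sV : Γ(F, V) := F.presheaf.map (homOfLE (le_top : V ≤ ⊤)).op s with hsV
  -- the coordinates over `V` are the restrictions of those over `W`, `W'`
  have hcV : ∀ i, coord e k sV i =
      X.presheaf.map k.op (coord e (𝟙 W) (F.presheaf.map (homOfLE (le_top : W ≤ ⊤)).op s) i) := fun i => by
    rw [← coord_map, Category.comp_id, hsV, ← CategoryTheory.comp_apply, ← Functor.map_comp]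
    rfl
  have hcV' : ∀ j, coord e' k' sV j =
      X.presheaf.map k'.op (coord e' (𝟙 W') (F.presheaf.map (homOfLE (le_top : W' ≤ ⊤)).op s) j) := fun j => by
    rw [← coord_map, Category.comp_id, hsV, ← CategoryTheory.comp_apply, ← Functor.map_comp]
    rfl
  -- all `e'`-coordinates of `sV` have germ in `𝔪_x`
  have hm' : ∀ j, X.presheaf.germ V x hxV (coord e' k' sV j) ∈ IsLocalRing.maximalIdeal _ := fun j => by
    rw [hcV', X.presheaf.germ_res_apply k' x hxV]
    exact (not_mem_basicOpen_iff_germ_mem_maximalIdeal _ hxW').mp (hne' j)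
  -- expand `sV` in the frame `e'` and take the `i`-th `e`-coordinate
  have hexp : coord e k sV i = ∑ j, coord e' k' sV j * coord e k (F.presheaf.map k'.op (basisSection e' j)) i := by
    conv_lhs => rw [eq_sum_coord_smul e' k' sV]
    rw [coord_sum]
    exact Finset.sum_congr rfl fun j _ => coord_smul e k _ _ i
  have hm : X.presheaf.germ V x hxV (coord e k sV i) ∈ IsLocalRing.maximalIdeal _ := by
    rw [hexp, map_sum]
    exact Ideal.sum_mem _ fun j _ => by
      rw [map_mul]; exact Ideal.mul_mem_right _ _ (hm' j)
  -- contradiction with the invertibility of the `i`-th `e`-coordinate at `x`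
  rw [hcV, X.presheaf.germ_res_apply k x hxV, ← not_mem_basicOpen_iff_germ_mem_maximalIdeal _ hxW] at hm
  exact hm hi

/-- For a nowhere-vanishing section, in EVERY frame around `x` some coordinate is invertible at `x`. [folklore] -/
theorem IsNowhereVanishing.exists_mem_basicOpen {s : Γ(F, ⊤)} (hs : IsNowhereVanishing F s) (x : X)
    {W' : X.Opens} (hxW' : x ∈ W') {I' : Type u} [Finite I'] (e' : SheafOfModules.free I' ≅ F.over W') :
    ∃ j, x ∈ X.basicOpen (coord e' (𝟙 W') (F.presheaf.map (homOfLE (le_top : W' ≤ ⊤)).op s) j) := by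
  obtain ⟨W, hxW, I, hI, e, i, hi⟩ := hs x
  haveI : Finite I := hI
  haveI := Fintype.ofFinite I
  haveI := Fintype.ofFinite I'
  exact exists_mem_basicOpen_coord hxW e ⟨i, hi⟩ hxW' e'

end Def

/-! ### Coordinates of pulled-back sections in the pulled-back frame -/

section Pullback

variable {X Y : Scheme.{u}} (g : Y ⟶ X) (F : X.Modules)

/-- **In the pulled-back frame `g^*e`, the coordinates of `η(s)` are the pull-backs `g♯(λ_i(s))` of the
coordinates of `s`.** [folklore] -/
theorem coord_pullbackFrame_unitSection {U : X.Opens} {I : Type u} [Fintype I] (e : SheafOfModules.free I ≅ F.over U)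
    (s : Γ(F, U)) (i : I) :
    coord (E := (Scheme.Modules.pullback g).obj F) (pullbackFrame g e) (𝟙 (g ⁻¹ᵁ U)) (unitSection g F U s) i =
      g.app U (coord e (𝟙 U) s i) := by
  classical
  have hexp : unitSection g F U s = ∑ j, g.app U (coord e (𝟙 U) s j) •
      ((Scheme.Modules.pullback g).obj F).presheaf.map (𝟙 (g ⁻¹ᵁ U)).op
        (basisSection (E := (Scheme.Modules.pullback g).obj F) (pullbackFrame g e) j) := by
    conv_lhs => rw [eq_sum_coord_smul e (𝟙 U) s, unitSection_sum]
    refine Finset.sum_congr rfl fun j _ => ?_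
    rw [unitSection_smul, unitSection_map, basisSection_pullbackFrame]
    rfl
  rw [hexp, coord_sum_smul_basisSection]

end Pullback

/-! ### A lift of a nowhere-vanishing section is nowhere vanishing (proper over a local base) -/

section Lift

variable {A B : Type u} [CommRing A] [IsLocalRing A] [CommRing B] [Nontrivial B] (φ : A →+* B)
  {X Y : Scheme.{u}} (f : X ⟶ Spec (.of A)) {g : Y ⟶ X} {t : Y ⟶ Spec (.of B)}

/-- In a cartesian square the image of the first projection is the preimage of the image of the opposite side
(Mathlib `Scheme.Pullback.range_fst` along `IsPullback.isoPullback`). [folklore] -/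
theorem range_eq_preimage_range_of_isPullback {Z W : Scheme.{u}} {fst : Y ⟶ X} {snd : Y ⟶ Z} {f' : X ⟶ W}
    {g' : Z ⟶ W} (H : IsPullback fst snd f' g') : Set.range fst.base = f'.base ⁻¹' Set.range g'.base := by
  rw [← H.isoPullback_hom_fst, Scheme.Hom.comp_base, TopCat.coe_comp, Set.range_comp,
    show Set.range ⇑H.isoPullback.hom = Set.univ from
      Set.range_eq_univ.mpr H.isoPullback.hom.homeomorph.surjective, Set.image_univ]
  exact Scheme.Pullback.range_fst f' g'

/-- **Every point of `X` specialises to a point of the image of `g`** when `f : X → Spec A` is universally closed,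
`A` is local and `g` is the base change of `Spec φ` for a surjection `φ : A → B ≠ 0` (the image of `Spec φ` is
`V(ker φ) ∋ 𝔪_A`). [folklore] -/
theorem exists_specializes_mem_range [UniversallyClosed f] (hφ : Function.Surjective φ)
    (H : IsPullback g t f (Spec.map (CommRingCat.ofHom φ))) (x : X) :
    ∃ y : Y, x ⤳ g.base y := by
  -- a specialisation `x'` of `x` over the closed point
  have hcl : IsClosed (f.base '' closure {x}) := f.isClosedMap _ isClosed_closure
  have h𝔪 : IsLocalRing.closedPoint A ∈ f.base '' closure {x} :=
    (IsLocalRing.specializes_closedPoint (f.base x)).mem_closed hcl ⟨x, subset_closure rfl, rfl⟩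
  obtain ⟨x', hx'cl, hfx'⟩ := h𝔪
  have hxx' : x ⤳ x' := specializes_iff_mem_closure.mpr hx'cl
  -- `x'` lies in the image of `g`
  have hrange : x' ∈ Set.range g.base := by
    rw [range_eq_preimage_range_of_isPullback H, Set.mem_preimage, hfx']
    have hr : Set.range (Spec.map (CommRingCat.ofHom φ)).base = PrimeSpectrum.zeroLocus (RingHom.ker φ) := by
      rw [← range_comap_of_surjective _ _ hφ]
      rfl
    rw [hr, PrimeSpectrum.mem_zeroLocus]
    exact IsLocalRing.le_maximalIdeal (RingHom.ker_ne_top φ)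
  obtain ⟨y, hy⟩ := hrange
  exact ⟨y, hy ▸ hxx'⟩

/-- **T-P1VB — a lift of a nowhere-vanishing section is nowhere vanishing.** Let `A` be local, `φ : A → B` a surjection
onto a non-zero ring, `f : X → Spec A` universally closed (e.g. proper), `g : Y = X ×_A B → X` the base change, `F` a finite
locally free `𝒪_X`-module and `s ∈ Γ(X, F)`. If the pulled-back section `η(s) ∈ Γ(Y, g^*F)` is nowhere vanishing, so is
`s`: the locus where `s` vanishes is closed under specialisation and every point of `X` specialises into the special
fibre `g(Y)`, where `s` does not vanish. [folklore] -/
theorem IsNowhereVanishing.of_unitSection [UniversallyClosed f] (hφ : Function.Surjective φ)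
    (H : IsPullback g t f (Spec.map (CommRingCat.ofHom φ))) {F : X.Modules} (hF : Motives.IsFiniteLocallyFree F)
    (s : Γ(F, ⊤))
    (hs : IsNowhereVanishing ((Scheme.Modules.pullback g).obj F) (unitSection g F ⊤ s)) :
    IsNowhereVanishing F s := by
  intro x
  obtain ⟨y, hxy⟩ := exists_specializes_mem_range φ f hφ H x
  -- a frame at `g y`
  obtain ⟨U, hyU, I, hI, ⟨e⟩⟩ := hF (g.base y)
  haveI := Fintype.ofFinite I
  -- downstairs, in the pulled-back frame, some coordinate of `η(s)|_{g⁻¹U} = η(s|_U)` is invertible at `y`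
  obtain ⟨i, hi⟩ := hs.exists_mem_basicOpen y (show y ∈ g ⁻¹ᵁ U from hyU) (pullbackFrame g e)
  have hres : ((Scheme.Modules.pullback g).obj F).presheaf.map (homOfLE (le_top : g ⁻¹ᵁ U ≤ ⊤)).op
      (unitSection g F ⊤ s) = unitSection g F U (F.presheaf.map (homOfLE (le_top : U ≤ ⊤)).op s) := by
    rw [unitSection_map]
    rfl
  rw [hres, coord_pullbackFrame_unitSection, ← Scheme.preimage_basicOpen] at hi
  -- hence that coordinate of `s|_U` is invertible at `g y`, hence at `x ⤳ g y`
  exact ⟨U, hxy.mem_open U.isOpen hyU, I, hI, e, i, hxy.mem_open (X.basicOpen _).isOpen hi⟩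

end Lift

end Summit.ResolutionOfSingularities.ResolutionOfSingularities.Cruxes.EquisingularLiftNat.P1VB

end
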